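import Summits.CriticalPhenomena.PercolationContinuityZ3.Theorems.PercNearOneGluingNoHeavyLowerTailSahiMixtureSingletonFiveThree
import Summits.CriticalPhenomena.PercolationContinuityZ3.Theorems.PercNearOneGluingNoHeavyLowerTailSahiMixtureHereditaryCex5

/-!
# H-MIX fails at EVERY `n ≥ 5` for EVERY number `g` of OR-ed members with `2 ≤ g ≤ n − 2` (padding and duplication of the `n = 5` witnesses)

Support file of the one-cut programme (crux `NoHeavyLowerTail`, stmt-CriticalPhenomena-4575; cell `prim-masterthm`, seat P3, gen 13;
`run/shared/lean/prim/prim-masterthm/prim-masterthm-p3/HIERARCHY.md` §21).  The hereditary class `𝒦_n` (`HereditaryAllOrders`) is closed under passing to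
DERIVED families `(⋂_{i∈φ j} A_i)_j` (`HereditaryAllOrders.comp`, gen 7) — in particular under adjoining the sure event `Ω` (`φ j = ∅`) and under DUPLICATING a
member (`φ j = {i}` twice); and a family containing a copy of a non-hereditary family is non-hereditary (`not_hereditaryAllOrders_of_section`).  Hence the two
law-level `n = 5` witnesses of this programme — `cex5` (coin OR-ed into 2 of 5 members, `…HereditaryCex5`, gen 8) and `cex53` (3 of 5, `…SingletonFiveThree`,
gen 10) — propagate: OR-ing an independent fair coin into the first `g` of `n` members does NOT preserve `𝒦_n` whenever `2 ≤ g ≤ n − 2`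
(`hmixClosure_fails_of_three_le`: `3 ≤ g ≤ n − 2` from `cex53` with `g − 3` duplicates of an OR-ed member and `n − 2 − g` copies of `Ω`;
`hmixClosure_fails_of_two_le`: `2 ≤ g ≤ n − 3` from `cex5`; **`hmixClosure_fails`**: the union).  With the positive rungs this leaves, at each `n`, exactly
two cells of the H-MIX ladder: `g = n − 1` (SUBTOP(n): TRUE for `n ≤ 5`, OPEN for `n ≥ 6`) and `g = n` (TOP(n): TRUE from the top row for `n ≤ 9`, this gen).
HONEST FRAMING: the padded families are degenerate (repeated members, sure events) — statements about the closure property as typed (`HereditaryAllOrders` over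
arbitrary `Fin n`-indexed families); `g ≤ 1` is TRUE for every `n` (gen 11).  Nothing here asserts or refutes (M⁺-k) or `C_k`. [this work]
-/

noncomputable section

open scoped Classical

namespace Summit.CriticalPhenomena.PercolationContinuityZ3.Theorems

open Finset Function
open Literature.Combinatorics.Sahi2008
open Literature.Probability.Percolation.DecisionTree (ind)

namespace SahiMixture

section Transfer

variable {β : Type*} [Fintype β] {ν : β → ℝ} {n n' : ℕ}

/-- A family that contains (as members) a copy of a non-hereditary family is non-hereditary. [this work] -/
theorem not_hereditaryAllOrders_of_section {B : Fin n → Set β} {B' : Fin n' → Set β} (ψ : Fin n → Fin n')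
    (hψ : ∀ i, B' (ψ i) = B i) (h : ¬ HereditaryAllOrders ν B) : ¬ HereditaryAllOrders ν B' := by
  intro hB'
  apply h
  have hc := hB'.comp (fun i => ({ψ i} : Finset (Fin n')))
  have e : (fun i => ⋂ l ∈ ({ψ i} : Finset (Fin n')), B' l) = B := by
    funext i; rw [Finset.set_biInter_singleton, hψ]
  rwa [e] at hc

omit [Fintype β] in
/-- OR-ing a coin into the sure event changes nothing: `orCoin Ω b = Ω`. [this work] -/
theorem orCoin_univ (b : Bool) : orCoin (Set.univ : Set β) b = Set.univ := by
  ext x; simp [orCoin]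

end Transfer

section Padding

/-- The index map of the `cex53` padding: members `0,1,2` (OR-ed originals), then `g − 3` duplicates of member `0`, then the two plain originals `3, 4`,
then copies of `Ω`. [this work] -/
def pad53 (n g : ℕ) (j : Fin n) : Finset (Fin 5) :=
  if j.val < 3 then {⟨j.val % 5, Nat.mod_lt _ (by norm_num)⟩}
  else if j.val < g then {0}
  else if j.val < g + 2 then {⟨(j.val - g + 3) % 5, Nat.mod_lt _ (by norm_num)⟩}
  else ∅

/-- The padded `cex53` family. [this work] -/
def pad53A (n g : ℕ) : Fin n → Set (Fin 15) := fun j => ⋂ i ∈ pad53 n g j, cex53A i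

/-- The padded family is hereditarily all-orders positive (a derived family of `cex53A ∈ 𝒦_5`). [this work] -/
theorem hereditaryAllOrders_pad53 (n g : ℕ) : HereditaryAllOrders cex53Weight (pad53A n g) :=
  hereditaryAllOrders_cex53.comp (pad53 n g)

/-- **H-MIX fails for `3 ≤ g ≤ n − 2`**: OR-ing an independent fair coin into the first `g` of the `n` members of the hereditary family `pad53A n g`
leaves the hereditary class. [this work] -/
theorem hmixClosure_fails_of_three_le (n g : ℕ) (h3 : 3 ≤ g) (hg : g + 2 ≤ n) :
    HereditaryAllOrders cex53Weight (pad53A n g)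
    ∧ ¬ HereditaryAllOrders (coinWeight cex53Weight (1/2 : ℝ)) (fun j => orCoin (pad53A n g j) (decide (j.val < g))) := by
  refine ⟨hereditaryAllOrders_pad53 n g, ?_⟩
  -- the section: originals 0,1,2 sit at 0,1,2; originals 3,4 sit at g, g+1
  let ψ : Fin 5 → Fin n := fun i => if h : i.val < 3 then ⟨i.val, by omega⟩ else ⟨i.val - 3 + g, by omega⟩
  refine not_hereditaryAllOrders_of_section ψ (fun i => ?_) not_hereditaryAllOrders_orCoin_cex53
  -- member ψ i of the padded OR family is the i-th member of the cex53 OR family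
  have hφ : pad53 n g (ψ i) = {i} := by
    fin_cases i <;> simp [ψ, pad53] <;> (first | omega | (split_ifs <;> first | omega | (ext k; simp)))
  have hF : decide ((ψ i).val < g) = cex53F i := by
    fin_cases i <;> simp [ψ, cex53F] <;> omega
  show orCoin (pad53A n g (ψ i)) (decide ((ψ i).val < g)) = orCoin (cex53A i) (cex53F i)
  rw [hF, pad53A]
  simp only [hφ, Finset.set_biInter_singleton]

/-- The index map of the `cex5` padding: members `0,1` (the OR-ed originals `2,3` of `cex5A`), then `g − 2` duplicates of original `2`, then the plain
originals `0, 1, 4`, then copies of `Ω`. [this work] -/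
def pad5 (n g : ℕ) (j : Fin n) : Finset (Fin 5) :=
  if j.val < 2 then {⟨(j.val + 2) % 5, Nat.mod_lt _ (by norm_num)⟩}
  else if j.val < g then {2}
  else if j.val < g + 2 then {⟨(j.val - g) % 5, Nat.mod_lt _ (by norm_num)⟩}
  else if j.val = g + 2 then {4}
  else ∅

/-- The padded `cex5` family. [this work] -/
def pad5A (n g : ℕ) : Fin n → Set (Fin 14) := fun j => ⋂ i ∈ pad5 n g j, cex5A i

/-- The padded family is hereditarily all-orders positive (a derived family of `cex5A ∈ 𝒦_5`). [this work] -/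
theorem hereditaryAllOrders_pad5 (n g : ℕ) : HereditaryAllOrders cex6Weight (pad5A n g) :=
  hereditaryAllOrders_cex5.comp (pad5 n g)

/-- **H-MIX fails for `2 ≤ g ≤ n − 3`**: OR-ing an independent fair coin into the first `g` of the `n` members of the hereditary family `pad5A n g`
leaves the hereditary class. [this work] -/
theorem hmixClosure_fails_of_two_le (n g : ℕ) (h2 : 2 ≤ g) (hg : g + 3 ≤ n) :
    HereditaryAllOrders cex6Weight (pad5A n g)
    ∧ ¬ HereditaryAllOrders (coinWeight cex6Weight (1/2 : ℝ)) (fun j => orCoin (pad5A n g j) (decide (j.val < g))) := by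
  refine ⟨hereditaryAllOrders_pad5 n g, ?_⟩
  -- the section: originals 2,3 sit at 0,1; originals 0,1 sit at g, g+1; original 4 sits at g+2
  let ψ : Fin 5 → Fin n := fun i =>
    if h : i.val < 2 then ⟨i.val + g, by omega⟩ else if h' : i.val < 4 then ⟨i.val - 2, by omega⟩ else ⟨g + 2, by omega⟩
  refine not_hereditaryAllOrders_of_section ψ (fun i => ?_) not_hereditaryAllOrders_orCoin_cex5
  have hφ : pad5 n g (ψ i) = {i} := by
    fin_cases i <;> simp [ψ, pad5] <;> (first | omega | (split_ifs <;> first | omega | (ext k; simp)))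
  have hF : decide ((ψ i).val < g) = (![false, false, true, true, false] : Fin 5 → Bool) i := by
    fin_cases i <;> simp [ψ] <;> omega
  show orCoin (pad5A n g (ψ i)) (decide ((ψ i).val < g)) = orCoin (cex5A i) ((![false, false, true, true, false] : Fin 5 → Bool) i)
  rw [hF, pad5A]
  simp only [hφ, Finset.set_biInter_singleton]

/-- **THE H-MIX LADDER BELOW `n − 1` IS EMPTY FROM `n = 5` ON**: for every `n ≥ 5` and every `g` with `2 ≤ g ≤ n − 2` there are a finite probability space, a hereditarily
all-orders-positive family of `n` events and an independent fair coin such that OR-ing the coin into the first `g` members leaves the hereditary class.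
(At `n ≤ 4` the closure holds for every `g` — H-MIX(3), H-MIX(4), gens 5–7; at `g ≤ 1` for every `n`, gen 11; `g = n − 1`, `g = n` are SUBTOP/TOP.) [this work] -/
theorem hmixClosure_fails (n g : ℕ) (h5 : 5 ≤ n) (h2 : 2 ≤ g) (hg : g + 2 ≤ n) :
    ∃ (α : Type) (_ : Fintype α) (μ : α → ℝ) (A : Fin n → Set α),
      (∀ a, 0 ≤ μ a) ∧ ∑ a, μ a = 1 ∧ HereditaryAllOrders μ A
      ∧ ¬ HereditaryAllOrders (coinWeight μ (1/2 : ℝ)) (fun j => orCoin (A j) (decide (j.val < g))) := by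
  by_cases h3 : 3 ≤ g
  · obtain ⟨hA, hN⟩ := hmixClosure_fails_of_three_le n g h3 hg
    exact ⟨Fin 15, inferInstance, cex53Weight, pad53A n g, cex53Weight_nonneg, sum_cex53Weight, hA, hN⟩
  · have hg2 : g = 2 := by omega
    subst hg2
    obtain ⟨hA, hN⟩ := hmixClosure_fails_of_two_le n 2 le_rfl (by omega)
    exact ⟨Fin 14, inferInstance, cex6Weight, pad5A n 2, cex6Weight_nonneg, sum_cex6Weight, hA, hN⟩

end Padding

end SahiMixture

end Summit.CriticalPhenomena.PercolationContinuityZ3.Theorems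

end
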